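import Literature.Analysis.FluidPDE.KwonSpaceTimeFields
import Literature.Analysis.FluidPDE.KwonSpaceTimeTest
import Literature.Analysis.FluidPDE.WholeSpaceIBP
import HarnessLib

/-!
# Kwon's Lemma 2.5: the space–time momentum equation of the perturbed system

Analysis/FluidPDE file on the discharge path of the named fact
`Literature.Analysis.FluidPDE.kwon2023_velocity_epsilon_regularity`
(`PressureFreeEpsilonRegularity.lean`; H. Kwon, J. Differential Equations (2023) =
arXiv:2104.03160, Thm. 1.4), twelfth brick of Lemma 2.5: the TIME-INTEGRATED momentum clause.
PRINTED (arXiv p. 8–9): "(NS) in `Q₂` with `Z = ζ` can be rewritten as (per.NS) for `v` on `B₁`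
… To summarize, `v` solves (per.NS) in `(−4,0) × B₁` in distribution sense with `q = …`,
`f = …`". The slice identity `Kwon2023.slice_momentum_identity_combined`
(`KwonSliceMomentum.lean`) is integrated in time against a space–time test field
`Ξ ∈ C_c^∞((−4,0) × B₁; ℝ³)`:

* `Kwon2023.IsGoodVelocity.locallyIntegrable(_sq)`, `Kwon2023.exists_norm_driftField_le_const`,
  `Kwon2023.locallyIntegrable_driftField(_sq)`, `Kwon2023.locallyIntegrable_sub_driftField(_sq)`:
  the classes of `W`, of the drift `h = H(W(t))` (uniformly bounded) and of `v = W − h` on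
  space–time (`L¹_loc`, `L²_loc`);
* `Kwon2023.ns_testField_identity`: the Navier–Stokes identity of `u` on `Q₂ = (−4,0) × B₂`
  tested with Kwon's field `Z(t,·) = ζ_{Ξ(t,·)} = −curl(φ curl Δ⁻¹Ξ(t,·))` (admissible:
  `isSpaceTimeTestOn_testField_slice`; `∂ₜζ_Ξ = ζ_{∂ₜΞ}`, `div ζ_Ξ = 0`, so the pressure drops
  out), transported to the good representative `W` of `u` and written as an iterated integral;
* `Kwon2023.ae_slice_momentum_identity`: for a.e. `t` the slice identity applies — the two
  gradient conditions `∫ ⟪W(t), ∇(φ div A_η)⟫ = 0` (`η = ∂ₜΞ(t), ΔΞ(t)`) hold for a.e. `t` by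
  the tree's `ae_integral_inner_gradient_eq_zero` (the weak divergence-free condition of `u` on
  `Q₂`, sliced) applied to the divergence test functions of
  `isSpaceTimeTestOn_cutoff_mul_divergence_testPotential_slice`;
* `Kwon2023.momentum_perturbed`: **the `momentum` clause (with `λ = 1`) of
  `Kwon2023.IsPerturbedSuitableOn O 1 h Dh f v q`** (`KwonPerturbedSuitable.lean`) on every open
  `O ⊆ (−4,0) × B₁` (Kwon: all of `(−4,0) × B₁`; the tree's consumers use `Q₁(0) = (−1,0) × B₁`,
  `parabolicCylinderOpens_one_le_kwonCyl`), for `v = W − h`, `h(t) = H(W(t))` (`driftField`),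
  `f(t) = f_{W(t)}` (`forceField`) and ANY field `q` which at a.e. time `t ∈ (−4,0)` agrees a.e.
  in space with the slice pressure `q_{W(t)}` (`kwonSlicePressure`; `momentum_perturbed_pressureField`
  for `q = pressureField W P`, `pressureField_ae_eq`) — given local integrability of `q` and `f`
  on `O` (the classes `q ∈ L^{3/2}(O)`, `f ∈ L¹_t L²_x(O)` of Def. 2.4, Kwon's (est.q)/(est.f),
  are proved elsewhere and imply it); the fields enter through pointwise identities
  `v t x = W t x − driftField W t x`, … so that the conclusion is literally the structure field;
* `Kwon2023.divFree_sub_driftField`, `Kwon2023.divFree_driftField`: the `divFree` and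
  `drift_divFree` clauses on `O` (`div h = 0` on `B₁`, `divergence_harmonicPart_eq_zero`);
* `Kwon2023.kwonCyl_two_eq_parabolicCylinderOpens`, `coe_kwonCyl_two_eq_parabolicCylinder`:
  `(−4,0) × B₂ = Q₂(0)`, so that the data of `IsSuitableWeakSolutionOn (Q₂(0)) 1 0 u p` and of
  `exists_isGoodVelocity` are in the form used here.

No NS-regularity statement is touched: this is one clause of the printed Lemma 2.5 on the way to
re-proving the INPUT Thm. 1.4.

## Mathlib / tree search

Tree (reused): `slice_momentum_identity_combined` (`KwonSliceMomentum`); `IsGoodVelocity`,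
`driftField`, `forceField`, `pressureField_ae_eq`, `stronglyMeasurable_uncurry_driftField`,
`exists_norm_driftField_le`, `contDiff_driftField` (`KwonSpaceTimeFields`); `kwonCyl`,
`exists_radius_lt_one`, `isSpaceTimeTestOn_cutoff_mul_divergence_testPotential_slice`
(`KwonSpaceTimeTest`); `isSpaceTimeTestOn_testField_slice(_top)`, `timeDeriv_testField_slice`
(`KwonTestFieldCalculus`); `divergence_testField` (`KwonTestField`);
`divergence_harmonicPart_eq_zero` (`KwonHarmonicPart`); `ae_integral_inner_gradient_eq_zero`,
`integrable_inner_of_locallyIntegrableOn`, `integrable_mul_of_locallyIntegrableOn`,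
`IsSpaceTimeTestOn.continuous_gradient_field/continuous_divergence_field`
(`SuitableWeakPressure`); `IsSpaceTimeTestOn.timeDeriv_top/fderiv_top/laplacian_top`,
`timeDeriv_eq_zero_of_notMem`, `fderiv_slice_eq_zero_of_notMem` (`HeatDuhamelBack`);
`IsSpaceTimeTestOn.timeDeriv_isSpaceTimeTestOn/laplacian_isSpaceTimeTestOn`,
`laplacian_slice_eq_zero_of_notMem_tsupport` (`DistributionalPressurePoisson`);
`integral_mul_divergence_add_eq_zero_left` (`WholeSpaceIBP`). Mathlib: `MemLp.locallyIntegrable`,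
`MemLp.norm_rpow_div`, `memLp_top_of_bound`, `integral_prod`, `Measure.volume_eq_prod`,
`setIntegral_eq_integral_of_forall_compl_eq_zero`, `ae_restrict_mem`.

## References

* H. Kwon, *The role of the pressure in the regularity theory for the Navier–Stokes equations*,
  J. Differential Equations 357 (2023) = arXiv:2104.03160: Lemma 2.5 and its proof (arXiv
  p. 8–9), Def. 2.4. [Kwon2023RolePressure]
-/

noncomputable section

open MeasureTheory Set Function Filter Topology TopologicalSpace Metric InnerProductSpace
  ContinuousLinearMap
open scoped NNReal ENNReal RealInnerProductSpace Convolution Laplacian ContDiff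

namespace Literature.Analysis.FluidPDE

namespace Kwon2023

variable {W : ℝ → EuclideanSpace ℝ (Fin 3) → EuclideanSpace ℝ (Fin 3)}

/-! ### Space–time classes of `W`, `h = H(W)` and `v = W − h` -/

section Classes

/-- A good velocity is in `L³` of space–time (the class `u ∈ L³(Q₂)` of the proof of Lemma 2.5).
[cite: Kwon2023RolePressure, Lemma 2.5 (proof, p. 8) with Def. 1.1] -/
theorem IsGoodVelocity.memLp_three_uncurry (hW : IsGoodVelocity W) :
    MemLp (uncurry W) 3 volume := by
  refine ⟨hW.stronglyMeasurable.aestronglyMeasurable, ?_⟩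
  rw [eLpNorm_lt_top_iff_lintegral_rpow_enorm_lt_top (by norm_num) (by norm_num)]
  simpa [ENNReal.toReal_ofNat] using hW.lintegral_cube_lt_top

/-- A good velocity is locally integrable on space–time. [cite: Kwon2023RolePressure, Lemma 2.5 (proof, p. 8) with Def. 1.1] -/
theorem IsGoodVelocity.locallyIntegrable (hW : IsGoodVelocity W) :
    LocallyIntegrable (uncurry W) volume :=
  hW.memLp_three_uncurry.locallyIntegrable (by norm_num)

/-- `|W|²` is locally integrable on space–time (`L³ ⊂ L²_loc`). [cite: Kwon2023RolePressure, Lemma 2.5 (proof, p. 8) with Def. 1.1] -/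
theorem IsGoodVelocity.locallyIntegrable_sq (hW : IsGoodVelocity W) :
    LocallyIntegrable (fun z => ‖uncurry W z‖ ^ 2) volume := by
  have h32 : (1 : ℝ≥0∞) ≤ 3 / 2 := by
    rw [ENNReal.le_div_iff_mul_le (by norm_num) (by norm_num)]; norm_num
  have h := (hW.memLp_three_uncurry.norm_rpow_div (2 : ℝ≥0∞)).locallyIntegrable h32
  have e : (fun z => ‖uncurry W z‖ ^ (2 : ℝ≥0∞).toReal) = fun z => ‖uncurry W z‖ ^ 2 := by
    funext z
    rw [ENNReal.toReal_ofNat, Real.rpow_two]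
  rwa [e] at h

/-- **Uniform `L¹(B₂)` bound of the slices** of a good velocity (`|w| ≤ (1 + |w|²)/2` and the
uniform `L²` bound `u ∈ L^∞_t L²_x(Q₂)` of Def. 1.1). [cite: Kwon2023RolePressure, Def. 1.1 and Remark 2.3 (est.h)] -/
theorem IsGoodVelocity.exists_setIntegral_norm_le (hW : IsGoodVelocity W) :
    ∃ B : ℝ, ∀ t, ∫ y in ball (0 : EuclideanSpace ℝ (Fin 3)) 2, ‖W t y‖ ≤ B := by
  obtain ⟨A, hA⟩ := hW.sq_le_uniform
  refine ⟨(volume.real (ball (0 : EuclideanSpace ℝ (Fin 3)) 2) + A) / 2, fun t => ?_⟩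
  have hfin : volume (ball (0 : EuclideanSpace ℝ (Fin 3)) 2) < ⊤ := measure_ball_lt_top
  have hI1 : IntegrableOn (fun y => ‖W t y‖) (ball (0 : EuclideanSpace ℝ (Fin 3)) 2) :=
    (hW.integrable t).norm.integrableOn
  have hc1 : IntegrableOn (fun _ : EuclideanSpace ℝ (Fin 3) => (1 : ℝ))
      (ball (0 : EuclideanSpace ℝ (Fin 3)) 2) := integrableOn_const hfin.ne
  have hsq : IntegrableOn (fun y => ‖W t y‖ ^ 2) (ball (0 : EuclideanSpace ℝ (Fin 3)) 2) :=
    (hW.integrable_sq t).integrableOn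
  have hI2 : IntegrableOn (fun y => (1 + ‖W t y‖ ^ 2) / 2) (ball (0 : EuclideanSpace ℝ (Fin 3)) 2) :=
    (hc1.add hsq).div_const 2
  calc ∫ y in ball (0 : EuclideanSpace ℝ (Fin 3)) 2, ‖W t y‖
      ≤ ∫ y in ball (0 : EuclideanSpace ℝ (Fin 3)) 2, (1 + ‖W t y‖ ^ 2) / 2 :=
        integral_mono hI1 hI2 fun y => by
          dsimp only
          nlinarith [sq_nonneg (‖W t y‖ - 1)]
    _ = (volume.real (ball (0 : EuclideanSpace ℝ (Fin 3)) 2) +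
          ∫ y in ball (0 : EuclideanSpace ℝ (Fin 3)) 2, ‖W t y‖ ^ 2) / 2 := by
        rw [integral_div, integral_add hc1 hsq, setIntegral_const, smul_eq_mul, mul_one]
    _ ≤ (volume.real (ball (0 : EuclideanSpace ℝ (Fin 3)) 2) + A) / 2 := by
        gcongr
        exact (setIntegral_le_integral (hW.integrable_sq t) (Eventually.of_forall fun y => by
          positivity)).trans (hA t)

/-- **The drift is uniformly bounded on space–time**: `‖h(t, x)‖ ≤ M` for all `t, x`
((est.h) and the uniform `L¹(B₂)` bound of the slices). [cite: Kwon2023RolePressure, Remark 2.3 (est.h)] -/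
theorem exists_norm_driftField_le_const (hW : IsGoodVelocity W) :
    ∃ M : ℝ, 0 ≤ M ∧ ∀ t x, ‖driftField W t x‖ ≤ M := by
  obtain ⟨C, hC0, hC⟩ := exists_norm_driftField_le
  obtain ⟨B, hB⟩ := hW.exists_setIntegral_norm_le
  refine ⟨C * max B 0, mul_nonneg hC0 (le_max_right _ _), fun t x => (hC W hW t x).trans ?_⟩
  exact mul_le_mul_of_nonneg_left ((hB t).trans (le_max_left _ _)) hC0

/-- The drift is locally integrable on space–time (bounded and jointly measurable).
[cite: Kwon2023RolePressure, Lemma 2.5 with Remark 2.3 (est.h)] -/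
theorem locallyIntegrable_driftField (hW : IsGoodVelocity W) :
    LocallyIntegrable (uncurry (driftField W)) volume := by
  obtain ⟨M, -, hM⟩ := exists_norm_driftField_le_const hW
  exact (memLp_top_of_bound (stronglyMeasurable_uncurry_driftField hW).aestronglyMeasurable M
    (Eventually.of_forall fun z => hM z.1 z.2)).locallyIntegrable le_top

/-- `|h|²` is locally integrable on space–time. [cite: Kwon2023RolePressure, Lemma 2.5 with Remark 2.3 (est.h)] -/
theorem locallyIntegrable_driftField_sq (hW : IsGoodVelocity W) :
    LocallyIntegrable (fun z => ‖uncurry (driftField W) z‖ ^ 2) volume := by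
  obtain ⟨M, -, hM⟩ := exists_norm_driftField_le_const hW
  have hm : AEStronglyMeasurable (fun z => ‖uncurry (driftField W) z‖ ^ 2) volume :=
    (stronglyMeasurable_uncurry_driftField hW).aestronglyMeasurable.norm.pow 2
  refine (memLp_top_of_bound hm (M ^ 2) (Eventually.of_forall fun z => ?_)).locallyIntegrable le_top
  rw [Real.norm_eq_abs, abs_of_nonneg (by positivity)]
  exact pow_le_pow_left₀ (norm_nonneg _) (hM z.1 z.2) 2

/-- `v = W − h` is locally integrable on space–time (towards `v ∈ L^∞_t L²_x` of Def. 2.4).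
[cite: Kwon2023RolePressure, Lemma 2.5 with Def. 2.4] -/
theorem locallyIntegrable_sub_driftField (hW : IsGoodVelocity W) :
    LocallyIntegrable (uncurry fun t x => W t x - driftField W t x) volume :=
  hW.locallyIntegrable.sub (locallyIntegrable_driftField hW)

/-- `|v|² = |W − h|²` is locally integrable on space–time (towards `v ∈ L^∞_t L²_x` of Def. 2.4).
[cite: Kwon2023RolePressure, Lemma 2.5 with Def. 2.4] -/
theorem locallyIntegrable_sub_driftField_sq (hW : IsGoodVelocity W) :
    LocallyIntegrable (fun z => ‖uncurry (fun t x => W t x - driftField W t x) z‖ ^ 2) volume := by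
  have h1 := hW.locallyIntegrable_sq
  have h2 := locallyIntegrable_driftField_sq hW
  have hm : AEStronglyMeasurable
      (fun z => ‖uncurry (fun t x => W t x - driftField W t x) z‖ ^ 2) volume :=
    (hW.stronglyMeasurable.sub (stronglyMeasurable_uncurry_driftField hW)).aestronglyMeasurable.norm.pow 2
  refine ((h1.add h2).smul (2 : ℝ)).mono hm (Eventually.of_forall fun z => ?_)
  obtain ⟨t, x⟩ := z
  simp only [uncurry, Pi.add_apply, Pi.smul_apply, smul_eq_mul, Real.norm_eq_abs]
  rw [abs_of_nonneg (by positivity), abs_of_nonneg (by positivity)]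
  have h1 : ‖W t x - driftField W t x‖ ≤ ‖W t x‖ + ‖driftField W t x‖ := norm_sub_le _ _
  have h0 : 0 ≤ ‖W t x - driftField W t x‖ := norm_nonneg _
  nlinarith [mul_le_mul h1 h1 h0 (by positivity), sq_nonneg (‖W t x‖ - ‖driftField W t x‖)]

end Classes

/-! ### Integrability of quadratic pairings against compactly supported operator fields -/

section Pairings

/-- `z ↦ ⟪a(z), L(z) b(z)⟫` is integrable on space–time when `|a|², |b|²` are locally integrable
on `Q` and the continuous operator field `L` is supported in a compact subset of `Q`
(`|⟪a, L b⟫| ≤ ‖L‖ (|a|² + |b|²)`). [folklore] -/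
private theorem integrable_inner_clm_apply_of_sq {Q : Opens (ℝ × EuclideanSpace ℝ (Fin 3))}
    {a b : ℝ × EuclideanSpace ℝ (Fin 3) → EuclideanSpace ℝ (Fin 3)}
    (ham : AEStronglyMeasurable a volume) (hbm : AEStronglyMeasurable b volume)
    (ha : LocallyIntegrableOn (fun z => ‖a z‖ ^ 2) (Q : Set (ℝ × EuclideanSpace ℝ (Fin 3))) volume)
    (hb : LocallyIntegrableOn (fun z => ‖b z‖ ^ 2) (Q : Set (ℝ × EuclideanSpace ℝ (Fin 3))) volume)
    {L : ℝ × EuclideanSpace ℝ (Fin 3) → EuclideanSpace ℝ (Fin 3) →L[ℝ] EuclideanSpace ℝ (Fin 3)}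
    (hL : Continuous L) {K : Set (ℝ × EuclideanSpace ℝ (Fin 3))} (hK : IsCompact K)
    (hKQ : K ⊆ (Q : Set (ℝ × EuclideanSpace ℝ (Fin 3)))) (hLK : ∀ z ∉ K, L z = 0) :
    Integrable (fun z => ⟪a z, L z (b z)⟫) (volume : Measure (ℝ × EuclideanSpace ℝ (Fin 3))) := by
  have haK : IntegrableOn (fun z => ‖a z‖ ^ 2) K volume := ha.integrableOn_compact_subset hKQ hK
  have hbK : IntegrableOn (fun z => ‖b z‖ ^ 2) K volume := hb.integrableOn_compact_subset hKQ hK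
  have hLc : HasCompactSupport L := HasCompactSupport.intro hK hLK
  obtain ⟨C, hC⟩ := hL.bounded_above_of_compact_support hLc
  have hsupp : support (fun z => ⟪a z, L z (b z)⟫) ⊆ K := by
    intro z hz
    by_contra hzK
    exact hz (by simp [hLK z hzK])
  refine (integrableOn_iff_integrable_of_support_subset hsupp).1 ?_
  refine Integrable.mono' ((haK.add hbK).mul_const C)
    (ham.inner (isBoundedBilinearMap_apply.continuous.comp_aestronglyMeasurable
      (hL.aestronglyMeasurable.prodMk hbm))).restrict ?_
  filter_upwards with z
  have h0 : 0 ≤ C := (norm_nonneg _).trans (hC z)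
  calc ‖⟪a z, L z (b z)⟫‖ ≤ ‖a z‖ * ‖L z (b z)‖ := norm_inner_le_norm _ _
    _ ≤ ‖a z‖ * (C * ‖b z‖) := by
        refine mul_le_mul_of_nonneg_left ((le_opNorm _ _).trans ?_) (norm_nonneg _)
        exact mul_le_mul_of_nonneg_right (hC z) (norm_nonneg _)
    _ = C * (‖a z‖ * ‖b z‖) := by ring
    _ ≤ C * (‖a z‖ ^ 2 + ‖b z‖ ^ 2) := by
        refine mul_le_mul_of_nonneg_left ?_ h0
        nlinarith [sq_nonneg (‖a z‖ - ‖b z‖), norm_nonneg (a z), norm_nonneg (b z)]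
    _ = (‖a z‖ ^ 2 + ‖b z‖ ^ 2) * C := by ring

end Pairings

/-! ### Transport of the weak formulation from `u` to its good representative `W` -/

section Transport

variable {u : ℝ → EuclideanSpace ℝ (Fin 3) → EuclideanSpace ℝ (Fin 3)}
  {p : ℝ → EuclideanSpace ℝ (Fin 3) → ℝ}

/-- If `W = 1_O u` a.e., then `W = u` a.e. on `O`. [folklore] -/
private theorem ae_restrict_eq_of_ae_eq_indicator {O : Set (ℝ × EuclideanSpace ℝ (Fin 3))}
    (hO : MeasurableSet O) (hWu : uncurry W =ᵐ[volume] O.indicator (uncurry u)) :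
    ∀ᵐ z ∂(volume.restrict O), W z.1 z.2 = u z.1 z.2 := by
  filter_upwards [ae_restrict_mem hO, ae_restrict_of_ae hWu] with z hz h
  rw [indicator_of_mem hz] at h
  exact h

/-- **The weak divergence-free condition passes to the representative.** [folklore] -/
private theorem divFree_of_ae_eq {O : Opens (ℝ × EuclideanSpace ℝ (Fin 3))}
    (hdiv : ∀ θ : ℝ → EuclideanSpace ℝ (Fin 3) → ℝ, IsSpaceTimeTestOn O θ →
      ∫ z in (O : Set (ℝ × EuclideanSpace ℝ (Fin 3))), ⟪u z.1 z.2, gradient (θ z.1) z.2⟫ = 0)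
    (hWu : uncurry W =ᵐ[volume] (O : Set (ℝ × EuclideanSpace ℝ (Fin 3))).indicator (uncurry u)) :
    ∀ θ : ℝ → EuclideanSpace ℝ (Fin 3) → ℝ, IsSpaceTimeTestOn O θ →
      ∫ z in (O : Set (ℝ × EuclideanSpace ℝ (Fin 3))), ⟪W z.1 z.2, gradient (θ z.1) z.2⟫ = 0 := by
  intro θ hθ
  have hO : MeasurableSet (O : Set (ℝ × EuclideanSpace ℝ (Fin 3))) := O.isOpen.measurableSet
  refine (setIntegral_congr_ae hO ?_).trans (hdiv θ hθ)
  filter_upwards [(ae_restrict_iff' hO).1 (ae_restrict_eq_of_ae_eq_indicator hO hWu)]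
    with z hz hzO
  rw [hz hzO]

/-- **The Navier–Stokes identity tested with Kwon's field `ζ_Ξ`.** For a distributional
solution `(u, p)` of Navier–Stokes (`ν = 1`, `f = 0`) on `Q₂ = (−4,0) × B₂`, its good
representative `W` (`W = u` a.e. on `Q₂`) and `Ξ ∈ C_c^∞((−4,0) × B₁; ℝ³)`:
`∫∫_{Q₂} (⟪W, ζ_{∂ₜΞ}⟫ + ⟪W, (W·∇)ζ_Ξ⟫ + ⟪W, Δζ_Ξ⟫) = 0` — the test field
`Z(t,·) = ζ_{Ξ(t,·)}` is admissible on `Q₂`, `∂ₜZ = ζ_{∂ₜΞ}`, and `div Z = 0` kills the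
pressure. [cite: Kwon2023RolePressure, Lemma 2.5 (proof, p. 8)] -/
theorem ns_testField_identity (hu : IsDistributionalNSSolutionOn (kwonCyl (-4) 0 2) 1 0 u p)
    (hWu : uncurry W =ᵐ[volume]
      (kwonCyl (-4) 0 2 : Set (ℝ × EuclideanSpace ℝ (Fin 3))).indicator (uncurry u))
    {Ξ : ℝ → EuclideanSpace ℝ (Fin 3) → EuclideanSpace ℝ (Fin 3)}
    (hΞ : IsSpaceTimeTestOn (kwonCyl (-4) 0 1) Ξ) :
    ∫ z in (kwonCyl (-4) 0 2 : Set (ℝ × EuclideanSpace ℝ (Fin 3))),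
      (⟪W z.1 z.2, testField (timeDeriv Ξ z.1) z.2⟫ +
        ⟪W z.1 z.2, fderiv ℝ (testField (Ξ z.1)) z.2 (W z.1 z.2)⟫ +
        ⟪W z.1 z.2, (Δ (testField (Ξ z.1))) z.2⟫) = 0 := by
  have hΞ' : IsSpaceTimeTestOn (⊤ : Opens (ℝ × EuclideanSpace ℝ (Fin 3))) Ξ := hΞ.mono le_top
  have hZ : IsSpaceTimeTestOn (kwonCyl (-4) 0 2) (fun t => testField (Ξ t)) :=
    isSpaceTimeTestOn_testField_slice isOpen_ball hΞ
  obtain ⟨r, -, hr⟩ := exists_radius_lt_one hΞ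
  have key := hu.2.2.2.2 _ hZ
  have hO : MeasurableSet (kwonCyl (-4) 0 2 : Set (ℝ × EuclideanSpace ℝ (Fin 3))) :=
    (kwonCyl (-4) 0 2).isOpen.measurableSet
  -- simplify the integrand pointwise: `∂ₜζ_Ξ = ζ_{∂ₜΞ}`, `div ζ_Ξ = 0`, zero force
  have e1 : ∀ z : ℝ × EuclideanSpace ℝ (Fin 3),
      ⟪u z.1 z.2, timeDeriv (fun t => testField (Ξ t)) z.1 z.2⟫ +
        ⟪u z.1 z.2, convect (u z.1) (testField (Ξ z.1)) z.2⟫ +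
        1 * ⟪u z.1 z.2, (Δ (testField (Ξ z.1))) z.2⟫ +
        p z.1 z.2 * VectorCalculus.divergence (testField (Ξ z.1)) z.2 +
        ⟪(0 : ℝ → EuclideanSpace ℝ (Fin 3) → EuclideanSpace ℝ (Fin 3)) z.1 z.2, testField (Ξ z.1) z.2⟫ =
      ⟪u z.1 z.2, testField (timeDeriv Ξ z.1) z.2⟫ +
        ⟪u z.1 z.2, fderiv ℝ (testField (Ξ z.1)) z.2 (u z.1 z.2)⟫ +
        ⟪u z.1 z.2, (Δ (testField (Ξ z.1))) z.2⟫ := by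
    intro z
    rw [timeDeriv_testField_slice hΞ' z.1 z.2,
      divergence_testField (hΞ'.contDiff_slice z.1)
        (hasCompactSupport_of_tsupport_subset_closedBall (hr Ξ subset_rfl z.1)) z.2]
    simp only [convect, one_mul, mul_zero, add_zero, Pi.zero_apply, inner_zero_left]
  have key' : ∫ z in (kwonCyl (-4) 0 2 : Set (ℝ × EuclideanSpace ℝ (Fin 3))),
      (⟪u z.1 z.2, testField (timeDeriv Ξ z.1) z.2⟫ +
        ⟪u z.1 z.2, fderiv ℝ (testField (Ξ z.1)) z.2 (u z.1 z.2)⟫ +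
        ⟪u z.1 z.2, (Δ (testField (Ξ z.1))) z.2⟫) = 0 := by
    exact (setIntegral_congr_fun hO fun z _ => (e1 z).symm).trans key
  refine (setIntegral_congr_ae hO ?_).trans key'
  filter_upwards [(ae_restrict_iff' hO).1 (ae_restrict_eq_of_ae_eq_indicator hO hWu)]
    with z hz hzO
  rw [hz hzO]

end Transport

/-! ### Integrating the slice identity in time -/

section Assembly

variable {u v h f : ℝ → EuclideanSpace ℝ (Fin 3) → EuclideanSpace ℝ (Fin 3)}
  {p q : ℝ → EuclideanSpace ℝ (Fin 3) → ℝ}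
  {Ξ : ℝ → EuclideanSpace ℝ (Fin 3) → EuclideanSpace ℝ (Fin 3)}

/-- The time derivative field of `ψ` is supported in the support of `ψ` (the tree's
`tsupport_uncurry_timeDeriv_subset` of `WeakHeatOperatorCutoff`, restated privately to keep the
imports light). [folklore] -/
private theorem tsupport_uncurry_timeDeriv_subset_aux
    (ψ : ℝ → EuclideanSpace ℝ (Fin 3) → EuclideanSpace ℝ (Fin 3)) :
    tsupport (uncurry (timeDeriv ψ)) ⊆ tsupport (uncurry ψ) := by
  refine closure_minimal (fun q hq => ?_) (isClosed_tsupport _)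
  by_contra h
  exact hq (IsSpaceTimeTestOn.timeDeriv_eq_zero_of_notMem (ψ := ψ) (t := q.1) (x := q.2) h)

/-- `(−4,0) × B₁ ⊆ (−4,0) × B₂` (Kwon's cylinders `Q_ρ = (t₀ − ρ², t₀) × B_ρ(x₀)`).
[cite: Kwon2023RolePressure, §1 Notations and Lemma 2.5] -/
theorem kwonCyl_one_le_two : kwonCyl (-4) 0 1 ≤ kwonCyl (-4) 0 2 :=
  fun _ hz => ⟨hz.1, ball_subset_ball (by norm_num) hz.2⟩

/-- `(−4,0) × B₂` is the cylinder `Q₂(0)` of the tree (as sets). [cite: Kwon2023RolePressure, §1 Notations and Lemma 2.5] -/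
theorem coe_kwonCyl_two_eq_parabolicCylinder :
    (kwonCyl (-4) 0 2 : Set (ℝ × EuclideanSpace ℝ (Fin 3))) = parabolicCylinder 2 (0 : ℝ × EuclideanSpace ℝ (Fin 3)) := by
  rw [coe_kwonCyl, parabolicCylinder]
  norm_num

/-- `(−4,0) × B₂` is the cylinder `Q₂(0)` of the tree (as open sets). [cite: Kwon2023RolePressure, §1 Notations and Lemma 2.5] -/
theorem kwonCyl_two_eq_parabolicCylinderOpens :
    kwonCyl (-4) 0 2 = parabolicCylinderOpens 2 (0 : ℝ × EuclideanSpace ℝ (Fin 3)) :=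
  TopologicalSpace.Opens.ext (by
    rw [coe_kwonCyl_two_eq_parabolicCylinder, coe_parabolicCylinderOpens])

/-- The cylinder `Q₁(0) = (−1,0) × B₁` lies in `(−4,0) × B₁`. [cite: Kwon2023RolePressure, §1 Notations and Lemma 2.5] -/
theorem parabolicCylinderOpens_one_le_kwonCyl :
    parabolicCylinderOpens 1 (0 : ℝ × EuclideanSpace ℝ (Fin 3)) ≤ kwonCyl (-4) 0 1 := by
  intro z hz
  have hz' : z ∈ parabolicCylinder 1 (0 : ℝ × EuclideanSpace ℝ (Fin 3)) := hz
  simp only [mem_parabolicCylinder, Prod.fst_zero, Prod.snd_zero, dist_zero_right] at hz'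
  norm_num at hz'
  exact ⟨⟨by linarith [hz'.1.1], hz'.1.2⟩, mem_ball_zero_iff.2 hz'.2⟩

/-- **The slice identity holds at a.e. time.** If `W` is a good velocity, weakly divergence
free on `Q₂` in space–time, then for `Ξ ∈ C_c^∞((−4,0) × B₁; ℝ³)` and a.e. `t` the two gradient
conditions of `slice_momentum_identity_combined` at `η = ∂ₜΞ(t)`, `ΔΞ(t)` hold (the weak
divergence-free condition sliced at the divergence test functions `φ div A_{∂ₜΞ}`,
`φ div A_{ΔΞ}`), hence the slice identity:
`∫ (⟪W, ζ_{∂ₜΞ}⟫ + ⟪W,(W·∇)ζ_Ξ⟫ + ⟪W, Δζ_Ξ⟫)(t) = ∫ (⟪v,∂ₜΞ⟫ + ⟪v,(v·∇)Ξ⟫ + ⟪h,(v·∇)Ξ⟫ +`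
`⟪v,(h·∇)Ξ⟫ + ⟪v,ΔΞ⟫ + q_{W(t)} div Ξ + ⟪f_{W(t)}, Ξ⟫)(t)`, `v = W − H W`, `h = H W`.
[cite: Kwon2023RolePressure, Lemma 2.5 (proof, p. 8–9)] -/
theorem ae_slice_momentum_identity (hW : IsGoodVelocity W)
    (hWdiv : ∀ θ : ℝ → EuclideanSpace ℝ (Fin 3) → ℝ, IsSpaceTimeTestOn (kwonCyl (-4) 0 2) θ →
      ∫ z in (kwonCyl (-4) 0 2 : Set (ℝ × EuclideanSpace ℝ (Fin 3))),
        ⟪W z.1 z.2, gradient (θ z.1) z.2⟫ = 0)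
    (hΞ : IsSpaceTimeTestOn (kwonCyl (-4) 0 1) Ξ) :
    ∀ᵐ t : ℝ, ∫ x, (⟪W t x, testField (timeDeriv Ξ t) x⟫ +
        ⟪W t x, fderiv ℝ (testField (Ξ t)) x (W t x)⟫ + ⟪W t x, (Δ (testField (Ξ t))) x⟫) =
      ∫ x, (⟪W t x - harmonicPart (W t) x, timeDeriv Ξ t x⟫
        + ⟪W t x - harmonicPart (W t) x, fderiv ℝ (Ξ t) x (W t x - harmonicPart (W t) x)⟫
        + ⟪harmonicPart (W t) x, fderiv ℝ (Ξ t) x (W t x - harmonicPart (W t) x)⟫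
        + ⟪W t x - harmonicPart (W t) x, fderiv ℝ (Ξ t) x (harmonicPart (W t) x)⟫
        + ⟪W t x - harmonicPart (W t) x, (Δ (Ξ t)) x⟫
        + kwonSlicePressure (W t) x * VectorCalculus.divergence (Ξ t) x
        + ⟪kwonSliceForce (W t) x, Ξ t x⟫) := by
  have hΞ' : IsSpaceTimeTestOn (⊤ : Opens (ℝ × EuclideanSpace ℝ (Fin 3))) Ξ := hΞ.mono le_top
  obtain ⟨r, hr1, hr⟩ := exists_radius_lt_one hΞ
  -- the two derived test fields `∂ₜΞ`, `ΔΞ` on `(−4,0) × B₁` and their divergence tests on `Q₂`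
  have hΨ₁ : IsSpaceTimeTestOn (kwonCyl (-4) 0 1) (timeDeriv Ξ) := hΞ.timeDeriv_isSpaceTimeTestOn
  have hΨ₂ : IsSpaceTimeTestOn (kwonCyl (-4) 0 1) (fun t y => (Δ (Ξ t)) y) :=
    hΞ.laplacian_isSpaceTimeTestOn
  have hΘ₁ : IsSpaceTimeTestOn (kwonCyl (-4) 0 2)
      (fun t x => kwonCutoff x * VectorCalculus.divergence (testPotential (timeDeriv Ξ t)) x) :=
    isSpaceTimeTestOn_cutoff_mul_divergence_testPotential_slice isOpen_ball hΨ₁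
  have hΘ₂ : IsSpaceTimeTestOn (kwonCyl (-4) 0 2)
      (fun t x => kwonCutoff x *
        VectorCalculus.divergence (testPotential fun y => (Δ (Ξ t)) y) x) :=
    isSpaceTimeTestOn_cutoff_mul_divergence_testPotential_slice isOpen_ball hΨ₂
  have hWloc : LocallyIntegrableOn (uncurry W)
      (kwonCyl (-4) 0 2 : Set (ℝ × EuclideanSpace ℝ (Fin 3))) volume :=
    hW.locallyIntegrable.locallyIntegrableOn _
  have h1 := ae_integral_inner_gradient_eq_zero hWloc hWdiv hΘ₁
  have h2 := ae_integral_inner_gradient_eq_zero hWloc hWdiv hΘ₂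
  filter_upwards [h1, h2] with t ht1 ht2
  exact slice_momentum_identity_combined (hW.aestronglyMeasurable_slice t) (hW.integrable t)
    (hW.integrable_sq t) (hW.memLp_three t) (hΞ'.contDiff_slice t)
    (hΞ'.timeDeriv_top.contDiff_slice t) hr1 (hr Ξ subset_rfl t)
    (hr (timeDeriv Ξ) (tsupport_uncurry_timeDeriv_subset_aux Ξ) t) ht1 ht2

/-- **Kwon's Lemma 2.5, the momentum equation of the perturbed system in the sense of
distributions** — the `momentum` clause (with `λ = 1`) of
`Kwon2023.IsPerturbedSuitableOn O 1 h Dh f v q` on any open `O ⊆ (−4,0) × B₁` (Kwon: all of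
`(−4,0) × B₁`; the tree's consumers use `Q₁(0) = (−1,0) × B₁`). Data: a distributional solution
`(u, p)` of Navier–Stokes (`ν = 1`, no force) on `Q₂ = (−4,0) × B₂`; a good representative `W`
of `u` (`exists_isGoodVelocity`); `v = W − h`, `h(t) = H(W(t))` the harmonic part
(`driftField`), `f(t) = f_{W(t)}` Kwon's force (`forceField`); a pressure field `q` which at
a.e. time `t ∈ (−4,0)` agrees a.e. in space with Kwon's slice pressure `q_{W(t)}` (e.g.
`pressureField W P`, `pressureField_ae_eq`); `q` and `f` locally integrable on `O`. Then for
every `Ξ ∈ C_c^∞(O; ℝ³)`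
`∫∫_O (⟪v, ∂ₜΞ⟫ + ⟪v, (v·∇)Ξ⟫ + ⟪h, (v·∇)Ξ⟫ + ⟪v, (h·∇)Ξ⟫ + ⟪v, ΔΞ⟫ + q div Ξ + ⟪f, Ξ⟫) = 0`.
Proof: the Navier–Stokes identity of `u` tested with `ζ_Ξ` (`ns_testField_identity`), Fubini,
the slice identity at a.e. time (`ae_slice_momentum_identity`), Fubini back.
[cite: Kwon2023RolePressure, Lemma 2.5] -/
theorem momentum_perturbed (hW : IsGoodVelocity W)
    (hu : IsDistributionalNSSolutionOn (parabolicCylinderOpens 2 (0 : ℝ × EuclideanSpace ℝ (Fin 3))) 1 0 u p)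
    (hWu : uncurry W =ᵐ[volume] (parabolicCylinder 2 (0 : ℝ × EuclideanSpace ℝ (Fin 3))).indicator (uncurry u))
    {O : Opens (ℝ × EuclideanSpace ℝ (Fin 3))} (hO : O ≤ kwonCyl (-4) 0 1)
    (hv : ∀ t x, v t x = W t x - driftField W t x) (hh : ∀ t x, h t x = driftField W t x)
    (hf : ∀ t x, f t x = forceField W t x)
    (hq : ∀ᵐ t ∂(volume.restrict (Ioo (-4 : ℝ) 0)), q t =ᵐ[volume] kwonSlicePressure (W t))
    (hqi : LocallyIntegrableOn (uncurry q) (O : Set (ℝ × EuclideanSpace ℝ (Fin 3))) volume)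
    (hfi : LocallyIntegrableOn (uncurry f) (O : Set (ℝ × EuclideanSpace ℝ (Fin 3))) volume) :
    ∀ Ξ : ℝ → EuclideanSpace ℝ (Fin 3) → EuclideanSpace ℝ (Fin 3), IsSpaceTimeTestOn O Ξ →
      ∫ z in (O : Set (ℝ × EuclideanSpace ℝ (Fin 3))),
        (⟪v z.1 z.2, timeDeriv Ξ z.1 z.2⟫ +
          1 * ⟪v z.1 z.2, convect (v z.1) (Ξ z.1) z.2⟫ +
          ⟪h z.1 z.2, convect (v z.1) (Ξ z.1) z.2⟫ + ⟪v z.1 z.2, convect (h z.1) (Ξ z.1) z.2⟫ +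
          ⟪v z.1 z.2, Δ (Ξ z.1) z.2⟫ + q z.1 z.2 * VectorCalculus.divergence (Ξ z.1) z.2 +
          ⟪f z.1 z.2, Ξ z.1 z.2⟫) = 0 := by
  rw [← kwonCyl_two_eq_parabolicCylinderOpens] at hu
  rw [← coe_kwonCyl_two_eq_parabolicCylinder] at hWu
  intro Ξ hΞO
  have hΞ : IsSpaceTimeTestOn (kwonCyl (-4) 0 1) Ξ := hΞO.mono hO
  have hΞ' : IsSpaceTimeTestOn (⊤ : Opens (ℝ × EuclideanSpace ℝ (Fin 3))) Ξ := hΞ.mono le_top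
  -- ### the fields `v`, `h` as functions on space–time
  have ev : (fun z : ℝ × EuclideanSpace ℝ (Fin 3) => v z.1 z.2) =
      uncurry fun t x => W t x - driftField W t x := by
    funext z; exact hv z.1 z.2
  have eh : (fun z : ℝ × EuclideanSpace ℝ (Fin 3) => h z.1 z.2) = uncurry (driftField W) := by
    funext z; exact hh z.1 z.2
  have hvm : AEStronglyMeasurable (fun z : ℝ × EuclideanSpace ℝ (Fin 3) => v z.1 z.2) volume := by
    rw [ev]
    exact (hW.stronglyMeasurable.sub (stronglyMeasurable_uncurry_driftField hW)).aestronglyMeasurable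
  have hhm : AEStronglyMeasurable (fun z : ℝ × EuclideanSpace ℝ (Fin 3) => h z.1 z.2) volume := by
    rw [eh]; exact (stronglyMeasurable_uncurry_driftField hW).aestronglyMeasurable
  have hvli : LocallyIntegrableOn (uncurry v) ((⊤ : Opens (ℝ × EuclideanSpace ℝ (Fin 3))) : Set (ℝ × EuclideanSpace ℝ (Fin 3))) volume := by
    rw [show uncurry v = fun z => v z.1 z.2 from rfl, ev]
    exact (locallyIntegrable_sub_driftField hW).locallyIntegrableOn _
  have hvsq : LocallyIntegrableOn (fun z : ℝ × EuclideanSpace ℝ (Fin 3) => ‖v z.1 z.2‖ ^ 2)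
      ((⊤ : Opens (ℝ × EuclideanSpace ℝ (Fin 3))) : Set (ℝ × EuclideanSpace ℝ (Fin 3))) volume := by
    have e : (fun z : ℝ × EuclideanSpace ℝ (Fin 3) => ‖v z.1 z.2‖ ^ 2) =
        fun z => ‖uncurry (fun t x => W t x - driftField W t x) z‖ ^ 2 := by
      funext z; rw [hv]; rfl
    rw [e]; exact (locallyIntegrable_sub_driftField_sq hW).locallyIntegrableOn _
  have hhsq : LocallyIntegrableOn (fun z : ℝ × EuclideanSpace ℝ (Fin 3) => ‖h z.1 z.2‖ ^ 2)
      ((⊤ : Opens (ℝ × EuclideanSpace ℝ (Fin 3))) : Set (ℝ × EuclideanSpace ℝ (Fin 3))) volume := by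
    have e : (fun z : ℝ × EuclideanSpace ℝ (Fin 3) => ‖h z.1 z.2‖ ^ 2) =
        fun z => ‖uncurry (driftField W) z‖ ^ 2 := by
      funext z; rw [hh]; rfl
    rw [e]; exact (locallyIntegrable_driftField_sq hW).locallyIntegrableOn _
  -- ### the test factors: continuity and vanishing off `K = supp Ξ ⊆ O`
  obtain ⟨K, hK⟩ : ∃ K : Set (ℝ × EuclideanSpace ℝ (Fin 3)), K = tsupport (uncurry Ξ) := ⟨_, rfl⟩
  have hKc : IsCompact K := hK ▸ hΞO.hasCompactSupport
  have hKO : K ⊆ (O : Set (ℝ × EuclideanSpace ℝ (Fin 3))) := hK ▸ hΞO.tsupport_subset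
  have hKO₁ : K ⊆ (kwonCyl (-4) 0 1 : Set (ℝ × EuclideanSpace ℝ (Fin 3))) := hK ▸ hΞ.tsupport_subset
  have hKU : K ⊆ ((⊤ : Opens (ℝ × EuclideanSpace ℝ (Fin 3))) : Set (ℝ × EuclideanSpace ℝ (Fin 3))) := by simp
  have cT : Continuous fun z : ℝ × EuclideanSpace ℝ (Fin 3) => timeDeriv Ξ z.1 z.2 :=
    hΞ'.timeDeriv_top.contDiff.continuous
  have cD : Continuous fun z : ℝ × EuclideanSpace ℝ (Fin 3) => fderiv ℝ (Ξ z.1) z.2 :=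
    hΞ'.fderiv_top.contDiff.continuous
  have cL : Continuous fun z : ℝ × EuclideanSpace ℝ (Fin 3) => (Δ (Ξ z.1)) z.2 :=
    hΞ'.laplacian_top.contDiff.continuous
  obtain ⟨cdiv, zdiv⟩ := hΞ.continuous_divergence_field
  have cΞ : Continuous fun z : ℝ × EuclideanSpace ℝ (Fin 3) => Ξ z.1 z.2 := hΞ.contDiff.continuous
  have zT : ∀ z ∉ K, timeDeriv Ξ z.1 z.2 = 0 := fun z hz =>
    IsSpaceTimeTestOn.timeDeriv_eq_zero_of_notMem (hK ▸ hz)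
  have zD : ∀ z ∉ K, fderiv ℝ (Ξ z.1) z.2 = 0 := fun z hz =>
    IsSpaceTimeTestOn.fderiv_slice_eq_zero_of_notMem (hK ▸ hz)
  have zL : ∀ z ∉ K, (Δ (Ξ z.1)) z.2 = 0 := fun z hz =>
    laplacian_slice_eq_zero_of_notMem_tsupport (hK ▸ hz)
  have zΞ : ∀ z ∉ K, Ξ z.1 z.2 = 0 := fun z hz =>
    (image_eq_zero_of_notMem_tsupport (hK ▸ hz) : uncurry Ξ z = 0)
  have zdivK : ∀ z ∉ K, VectorCalculus.divergence (Ξ z.1) z.2 = 0 := fun z hz => zdiv z (hK ▸ hz)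
  -- ### integrability of the seven terms of the perturbed integrand on space–time
  have I1 : Integrable (fun z : ℝ × EuclideanSpace ℝ (Fin 3) => ⟪v z.1 z.2, timeDeriv Ξ z.1 z.2⟫) :=
    integrable_inner_of_locallyIntegrableOn (Q := ⊤) hvli cT hKc hKU zT
  have I2 : Integrable (fun z : ℝ × EuclideanSpace ℝ (Fin 3) =>
      1 * ⟪v z.1 z.2, convect (v z.1) (Ξ z.1) z.2⟫) :=
    (integrable_inner_clm_apply_of_sq (Q := ⊤) hvm hvm hvsq hvsq cD hKc hKU zD).const_mul 1
  have I3 : Integrable (fun z : ℝ × EuclideanSpace ℝ (Fin 3) =>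
      ⟪h z.1 z.2, convect (v z.1) (Ξ z.1) z.2⟫) :=
    integrable_inner_clm_apply_of_sq (Q := ⊤) hhm hvm hhsq hvsq cD hKc hKU zD
  have I4 : Integrable (fun z : ℝ × EuclideanSpace ℝ (Fin 3) =>
      ⟪v z.1 z.2, convect (h z.1) (Ξ z.1) z.2⟫) :=
    integrable_inner_clm_apply_of_sq (Q := ⊤) hvm hhm hvsq hhsq cD hKc hKU zD
  have I5 : Integrable (fun z : ℝ × EuclideanSpace ℝ (Fin 3) => ⟪v z.1 z.2, (Δ (Ξ z.1)) z.2⟫) :=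
    integrable_inner_of_locallyIntegrableOn (Q := ⊤) hvli cL hKc hKU zL
  have I6 : Integrable (fun z : ℝ × EuclideanSpace ℝ (Fin 3) =>
      q z.1 z.2 * VectorCalculus.divergence (Ξ z.1) z.2) :=
    integrable_mul_of_locallyIntegrableOn (F := uncurry q) hqi cdiv hKc hKO zdivK
  have I7 : Integrable (fun z : ℝ × EuclideanSpace ℝ (Fin 3) => ⟪f z.1 z.2, Ξ z.1 z.2⟫) :=
    integrable_inner_of_locallyIntegrableOn hfi cΞ hKc hKO zΞ
  have IM : Integrable (fun z : ℝ × EuclideanSpace ℝ (Fin 3) =>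
      ⟪v z.1 z.2, timeDeriv Ξ z.1 z.2⟫ +
        1 * ⟪v z.1 z.2, convect (v z.1) (Ξ z.1) z.2⟫ +
        ⟪h z.1 z.2, convect (v z.1) (Ξ z.1) z.2⟫ + ⟪v z.1 z.2, convect (h z.1) (Ξ z.1) z.2⟫ +
        ⟪v z.1 z.2, Δ (Ξ z.1) z.2⟫ + q z.1 z.2 * VectorCalculus.divergence (Ξ z.1) z.2 +
        ⟪f z.1 z.2, Ξ z.1 z.2⟫) := (((((I1.add I2).add I3).add I4).add I5).add I6).add I7
  -- ### the perturbed integrand vanishes off `K ⊆ O`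
  have hzero : ∀ z : ℝ × EuclideanSpace ℝ (Fin 3), z ∉ (O : Set (ℝ × EuclideanSpace ℝ (Fin 3))) →
      ⟪v z.1 z.2, timeDeriv Ξ z.1 z.2⟫ +
        1 * ⟪v z.1 z.2, convect (v z.1) (Ξ z.1) z.2⟫ +
        ⟪h z.1 z.2, convect (v z.1) (Ξ z.1) z.2⟫ + ⟪v z.1 z.2, convect (h z.1) (Ξ z.1) z.2⟫ +
        ⟪v z.1 z.2, Δ (Ξ z.1) z.2⟫ + q z.1 z.2 * VectorCalculus.divergence (Ξ z.1) z.2 +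
        ⟪f z.1 z.2, Ξ z.1 z.2⟫ = 0 := by
    intro z hz
    have hzK : z ∉ K := fun h' => hz (hKO h')
    simp only [convect]
    rw [zT z hzK, zD z hzK, zL z hzK, zdivK z hzK, zΞ z hzK]
    simp
  -- ### the left-hand (Navier–Stokes) integrand: integrability and vanishing off `Q₂`
  have hZ : IsSpaceTimeTestOn (kwonCyl (-4) 0 2) (fun t => testField (Ξ t)) :=
    isSpaceTimeTestOn_testField_slice isOpen_ball hΞ
  have hZ' : IsSpaceTimeTestOn (⊤ : Opens (ℝ × EuclideanSpace ℝ (Fin 3))) (fun t => testField (Ξ t)) :=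
    hZ.mono le_top
  have hZT' : IsSpaceTimeTestOn (⊤ : Opens (ℝ × EuclideanSpace ℝ (Fin 3)))
      (fun t => testField (timeDeriv Ξ t)) :=
    isSpaceTimeTestOn_testField_slice_top hΞ'.timeDeriv_top
  have hKZc : IsCompact (tsupport (uncurry fun t => testField (Ξ t))) := hZ.hasCompactSupport
  have hKZO : tsupport (uncurry fun t => testField (Ξ t)) ⊆
      (kwonCyl (-4) 0 2 : Set (ℝ × EuclideanSpace ℝ (Fin 3))) := hZ.tsupport_subset
  have hWli : LocallyIntegrableOn (uncurry W) ((⊤ : Opens (ℝ × EuclideanSpace ℝ (Fin 3))) : Set (ℝ × EuclideanSpace ℝ (Fin 3))) volume :=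
    hW.locallyIntegrable.locallyIntegrableOn _
  have hWsq : LocallyIntegrableOn (fun z : ℝ × EuclideanSpace ℝ (Fin 3) => ‖W z.1 z.2‖ ^ 2)
      ((⊤ : Opens (ℝ × EuclideanSpace ℝ (Fin 3))) : Set (ℝ × EuclideanSpace ℝ (Fin 3))) volume :=
    hW.locallyIntegrable_sq.locallyIntegrableOn _
  have hKT : tsupport (uncurry fun t => testField (timeDeriv Ξ t)) ⊆
      ((⊤ : Opens (ℝ × EuclideanSpace ℝ (Fin 3))) : Set (ℝ × EuclideanSpace ℝ (Fin 3))) := by simp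
  have hKZU : tsupport (uncurry fun t => testField (Ξ t)) ⊆
      ((⊤ : Opens (ℝ × EuclideanSpace ℝ (Fin 3))) : Set (ℝ × EuclideanSpace ℝ (Fin 3))) := by simp
  have J1 : Integrable (fun z : ℝ × EuclideanSpace ℝ (Fin 3) =>
      ⟪W z.1 z.2, testField (timeDeriv Ξ z.1) z.2⟫) :=
    integrable_inner_of_locallyIntegrableOn (Q := ⊤) hWli hZT'.contDiff.continuous
      hZT'.hasCompactSupport hKT fun z hz =>
        (image_eq_zero_of_notMem_tsupport hz : uncurry (fun t => testField (timeDeriv Ξ t)) z = 0)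
  have J2 : Integrable (fun z : ℝ × EuclideanSpace ℝ (Fin 3) =>
      ⟪W z.1 z.2, fderiv ℝ (testField (Ξ z.1)) z.2 (W z.1 z.2)⟫) :=
    integrable_inner_clm_apply_of_sq (Q := ⊤) hW.stronglyMeasurable.aestronglyMeasurable
      hW.stronglyMeasurable.aestronglyMeasurable hWsq hWsq hZ'.fderiv_top.contDiff.continuous
      hKZc hKZU fun z hz =>
        IsSpaceTimeTestOn.fderiv_slice_eq_zero_of_notMem (ψ := fun t => testField (Ξ t))
          (t := z.1) (x := z.2) hz
  have cLZ : Continuous fun z : ℝ × EuclideanSpace ℝ (Fin 3) => (Δ (testField (Ξ z.1))) z.2 :=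
    hZ'.laplacian_top.contDiff.continuous
  have zLZ : ∀ z ∉ tsupport (uncurry fun t => testField (Ξ t)),
      (Δ (testField (Ξ z.1))) z.2 = 0 := fun z hz =>
    laplacian_slice_eq_zero_of_notMem_tsupport (ψ := fun t => testField (Ξ t)) (t := z.1)
      (x := z.2) hz
  have J3 : Integrable (fun z : ℝ × EuclideanSpace ℝ (Fin 3) =>
      ⟪W z.1 z.2, (Δ (testField (Ξ z.1))) z.2⟫) :=
    integrable_inner_of_locallyIntegrableOn (Q := ⊤) hWli cLZ hKZc hKZU zLZ
  have JM : Integrable (fun z : ℝ × EuclideanSpace ℝ (Fin 3) =>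
      ⟪W z.1 z.2, testField (timeDeriv Ξ z.1) z.2⟫ +
        ⟪W z.1 z.2, fderiv ℝ (testField (Ξ z.1)) z.2 (W z.1 z.2)⟫ +
        ⟪W z.1 z.2, (Δ (testField (Ξ z.1))) z.2⟫) := (J1.add J2).add J3
  have hzeroL : ∀ z : ℝ × EuclideanSpace ℝ (Fin 3),
      z ∉ (kwonCyl (-4) 0 2 : Set (ℝ × EuclideanSpace ℝ (Fin 3))) →
      ⟪W z.1 z.2, testField (timeDeriv Ξ z.1) z.2⟫ +
        ⟪W z.1 z.2, fderiv ℝ (testField (Ξ z.1)) z.2 (W z.1 z.2)⟫ +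
        ⟪W z.1 z.2, (Δ (testField (Ξ z.1))) z.2⟫ = 0 := by
    intro z hz
    have hzK : z ∉ tsupport (uncurry fun t => testField (Ξ t)) := fun h' => hz (hKZO h')
    have e1 : testField (timeDeriv Ξ z.1) z.2 = 0 := by
      rw [← timeDeriv_testField_slice hΞ' z.1 z.2]
      exact IsSpaceTimeTestOn.timeDeriv_eq_zero_of_notMem (ψ := fun t => testField (Ξ t))
        (t := z.1) (x := z.2) hzK
    have e2 : fderiv ℝ (testField (Ξ z.1)) z.2 = 0 :=
      IsSpaceTimeTestOn.fderiv_slice_eq_zero_of_notMem (ψ := fun t => testField (Ξ t))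
        (t := z.1) (x := z.2) hzK
    rw [e1, e2, zLZ z hzK]
    simp
  -- ### the Navier–Stokes identity as an iterated integral
  have key := ns_testField_identity hu hWu hΞ
  rw [setIntegral_eq_integral_of_forall_compl_eq_zero hzeroL, Measure.volume_eq_prod,
    integral_prod _ JM] at key
  -- ### the slice identity at a.e. time, and the pressure representative
  have hWdiv := divFree_of_ae_eq hu.2.2.2.1 hWu
  have hslice := ae_slice_momentum_identity hW hWdiv hΞ
  have hq' : ∀ᵐ t : ℝ, t ∈ Ioo (-4 : ℝ) 0 → q t =ᵐ[volume] kwonSlicePressure (W t) :=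
    (ae_restrict_iff' measurableSet_Ioo).1 hq
  have hae : ∀ᵐ t : ℝ, ∫ x, (⟪W t x, testField (timeDeriv Ξ t) x⟫ +
        ⟪W t x, fderiv ℝ (testField (Ξ t)) x (W t x)⟫ + ⟪W t x, (Δ (testField (Ξ t))) x⟫) =
      ∫ x, (⟪v t x, timeDeriv Ξ t x⟫ +
        1 * ⟪v t x, convect (v t) (Ξ t) x⟫ +
        ⟪h t x, convect (v t) (Ξ t) x⟫ + ⟪v t x, convect (h t) (Ξ t) x⟫ +
        ⟪v t x, Δ (Ξ t) x⟫ + q t x * VectorCalculus.divergence (Ξ t) x +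
        ⟪f t x, Ξ t x⟫) := by
    filter_upwards [hslice, hq'] with t ht htq
    rw [ht]
    refine integral_congr_ae ?_
    by_cases htI : t ∈ Ioo (-4 : ℝ) 0
    · filter_upwards [htq htI] with x hx
      simp only [hv, hh, hf, hx, convect, one_mul, driftField, forceField]
    · refine Eventually.of_forall fun x => ?_
      have hzx : ((t, x) : ℝ × EuclideanSpace ℝ (Fin 3)) ∉ K := fun h' => htI (hKO₁ h').1
      have hd : VectorCalculus.divergence (Ξ t) x = 0 := zdivK (t, x) hzx
      simp only [hv, hh, hf, hd, convect, one_mul, mul_zero, driftField, forceField]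
  -- ### assemble
  rw [setIntegral_eq_integral_of_forall_compl_eq_zero hzero, Measure.volume_eq_prod,
    integral_prod _ IM]
  exact (integral_congr_ae hae).symm.trans key

/-- `momentum_perturbed` for Kwon's pressure field `q = pressureField W P` built from a Riesz
representative `P` of the weighted slices (`exists_rieszRepresentative`). [cite: Kwon2023RolePressure, Lemma 2.5] -/
theorem momentum_perturbed_pressureField {P : ℝ → EuclideanSpace ℝ (Fin 3) → ℝ} (hW : IsGoodVelocity W)
    (hu : IsDistributionalNSSolutionOn (parabolicCylinderOpens 2 (0 : ℝ × EuclideanSpace ℝ (Fin 3))) 1 0 u p)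
    (hWu : uncurry W =ᵐ[volume] (parabolicCylinder 2 (0 : ℝ × EuclideanSpace ℝ (Fin 3))).indicator (uncurry u))
    {O : Opens (ℝ × EuclideanSpace ℝ (Fin 3))} (hO : O ≤ kwonCyl (-4) 0 1)
    (hv : ∀ t x, v t x = W t x - driftField W t x) (hh : ∀ t x, h t x = driftField W t x)
    (hf : ∀ t x, f t x = forceField W t x) (hq : ∀ t x, q t x = pressureField W P t x)
    (hP : ∀ᵐ t ∂(volume.restrict (Ioo (-4 : ℝ) 0)), P t =ᵐ[volume] rieszPressure (sqrtCutoffSMul (W t)))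
    (hqi : LocallyIntegrableOn (uncurry q) (O : Set (ℝ × EuclideanSpace ℝ (Fin 3))) volume)
    (hfi : LocallyIntegrableOn (uncurry f) (O : Set (ℝ × EuclideanSpace ℝ (Fin 3))) volume) :
    ∀ Ξ : ℝ → EuclideanSpace ℝ (Fin 3) → EuclideanSpace ℝ (Fin 3), IsSpaceTimeTestOn O Ξ →
      ∫ z in (O : Set (ℝ × EuclideanSpace ℝ (Fin 3))),
        (⟪v z.1 z.2, timeDeriv Ξ z.1 z.2⟫ +
          1 * ⟪v z.1 z.2, convect (v z.1) (Ξ z.1) z.2⟫ +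
          ⟪h z.1 z.2, convect (v z.1) (Ξ z.1) z.2⟫ + ⟪v z.1 z.2, convect (h z.1) (Ξ z.1) z.2⟫ +
          ⟪v z.1 z.2, Δ (Ξ z.1) z.2⟫ + q z.1 z.2 * VectorCalculus.divergence (Ξ z.1) z.2 +
          ⟪f z.1 z.2, Ξ z.1 z.2⟫) = 0 := by
  refine momentum_perturbed hW hu hWu hO hv hh hf ?_ hqi hfi
  filter_upwards [hP] with t ht
  have e : q t = pressureField W P t := funext (hq t)
  rw [e]
  exact pressureField_ae_eq ht

end Assembly

/-! ### The divergence-free clauses -/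

section DivFree

variable {v h : ℝ → EuclideanSpace ℝ (Fin 3) → EuclideanSpace ℝ (Fin 3)} {O : Opens (ℝ × EuclideanSpace ℝ (Fin 3))}

/-- **`div h = 0` weakly on `O ⊆ (−4,0) × B₁`** (the `drift_divFree` clause): the slices of the
drift are smooth with `div H(W(t)) = 0` on `B₁` (`divergence_harmonicPart_eq_zero`), so
`∫ ⟪h(t), ∇θ(t)⟫ = −∫ θ(t) div h(t) = 0` slice by slice, and Fubini. [cite: Kwon2023RolePressure, Lemma 2.5] -/
theorem divFree_driftField (hW : IsGoodVelocity W) (hO : O ≤ kwonCyl (-4) 0 1)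
    (hh : ∀ t x, h t x = driftField W t x) :
    ∀ θ : ℝ → EuclideanSpace ℝ (Fin 3) → ℝ, IsSpaceTimeTestOn O θ →
      ∫ z in (O : Set (ℝ × EuclideanSpace ℝ (Fin 3))), ⟪h z.1 z.2, gradient (θ z.1) z.2⟫ = 0 := by
  intro θ hθ
  obtain ⟨cg, -, zg⟩ := hθ.continuous_gradient_field
  have eh : uncurry h = uncurry (driftField W) := by
    funext z; exact hh z.1 z.2
  have hhli : LocallyIntegrableOn (uncurry h) (O : Set (ℝ × EuclideanSpace ℝ (Fin 3))) volume := by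
    rw [eh]; exact (locallyIntegrable_driftField hW).locallyIntegrableOn _
  have I : Integrable (fun z : ℝ × EuclideanSpace ℝ (Fin 3) => ⟪h z.1 z.2, gradient (θ z.1) z.2⟫) :=
    integrable_inner_of_locallyIntegrableOn hhli cg hθ.hasCompactSupport hθ.tsupport_subset zg
  have hzero : ∀ z : ℝ × EuclideanSpace ℝ (Fin 3), z ∉ (O : Set (ℝ × EuclideanSpace ℝ (Fin 3))) →
      ⟪h z.1 z.2, gradient (θ z.1) z.2⟫ = 0 := fun z hz => by
    rw [zg z fun h' => hz (hθ.tsupport_subset h'), inner_zero_right]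
  rw [setIntegral_eq_integral_of_forall_compl_eq_zero hzero, Measure.volume_eq_prod,
    integral_prod _ I]
  refine integral_eq_zero_of_ae (Eventually.of_forall fun t => ?_)
  -- one slice: `∫ ⟪h(t), ∇θ(t)⟫ = -∫ θ(t) div h(t) = 0`
  have eht : h t = driftField W t := funext (hh t)
  have hθ1 : ContDiff ℝ 1 (θ t) := contDiff_infty.1 (hθ.contDiff_slice t) 1
  have hh1 : ContDiff ℝ 1 (h t) := by rw [eht]; exact contDiff_driftField hW t
  have hibp := integral_mul_divergence_add_eq_zero_left hθ1 hh1 (hθ.hasCompactSupport_slice t)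
  have hdiv0 : ∫ x, θ t x * VectorCalculus.divergence (h t) x = 0 := by
    refine integral_eq_zero_of_ae (Eventually.of_forall fun x => ?_)
    by_cases hx : θ t x = 0
    · simp [hx]
    · have hmem : ((t, x) : ℝ × EuclideanSpace ℝ (Fin 3)) ∈ (kwonCyl (-4) 0 1 : Set (ℝ × EuclideanSpace ℝ (Fin 3))) :=
        hO (hθ.tsupport_subset (subset_tsupport _ (by simpa using hx)))
      have hx1 : ‖x‖ < 1 := by simpa using hmem.2
      have h0 : VectorCalculus.divergence (h t) x = 0 := by
        rw [eht]
        exact divergence_harmonicPart_eq_zero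
          (integrable_scalarDensity (hW.integrableOn_slice t)).locallyIntegrable
          (integrable_vectorDensity (hW.integrableOn_slice t)).locallyIntegrable hx1
      simp [h0]
  show ∫ x, ⟪h t x, gradient (θ t) x⟫ = 0
  linarith

/-- **`div v = 0` weakly on `O ⊆ (−4,0) × B₁`** for `v = W − h` (the `divFree` clause): `W` is
weakly divergence free on `Q₂` (transported from `u`) and `h` is (`divFree_driftField`).
[cite: Kwon2023RolePressure, Lemma 2.5, Remark 2.2] -/
theorem divFree_sub_driftField {u : ℝ → EuclideanSpace ℝ (Fin 3) → EuclideanSpace ℝ (Fin 3)} {p : ℝ → EuclideanSpace ℝ (Fin 3) → ℝ} (hW : IsGoodVelocity W)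
    (hu : IsDistributionalNSSolutionOn (parabolicCylinderOpens 2 (0 : ℝ × EuclideanSpace ℝ (Fin 3))) 1 0 u p)
    (hWu : uncurry W =ᵐ[volume] (parabolicCylinder 2 (0 : ℝ × EuclideanSpace ℝ (Fin 3))).indicator (uncurry u))
    (hO : O ≤ kwonCyl (-4) 0 1) (hv : ∀ t x, v t x = W t x - driftField W t x) :
    ∀ θ : ℝ → EuclideanSpace ℝ (Fin 3) → ℝ, IsSpaceTimeTestOn O θ →
      ∫ z in (O : Set (ℝ × EuclideanSpace ℝ (Fin 3))), ⟪v z.1 z.2, gradient (θ z.1) z.2⟫ = 0 := by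
  rw [← kwonCyl_two_eq_parabolicCylinderOpens] at hu
  rw [← coe_kwonCyl_two_eq_parabolicCylinder] at hWu
  have hWdiv := divFree_of_ae_eq hu.2.2.2.1 hWu
  intro θ hθ
  obtain ⟨cg, -, zg⟩ := hθ.continuous_gradient_field
  have hθ₂ : IsSpaceTimeTestOn (kwonCyl (-4) 0 2) θ := hθ.mono (hO.trans kwonCyl_one_le_two)
  have hWli : LocallyIntegrableOn (uncurry W) (O : Set (ℝ × EuclideanSpace ℝ (Fin 3))) volume :=
    hW.locallyIntegrable.locallyIntegrableOn _
  have hhli : LocallyIntegrableOn (uncurry (driftField W)) (O : Set (ℝ × EuclideanSpace ℝ (Fin 3))) volume :=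
    (locallyIntegrable_driftField hW).locallyIntegrableOn _
  have IW : Integrable (fun z : ℝ × EuclideanSpace ℝ (Fin 3) => ⟪W z.1 z.2, gradient (θ z.1) z.2⟫) :=
    integrable_inner_of_locallyIntegrableOn hWli cg hθ.hasCompactSupport hθ.tsupport_subset zg
  have Ih : Integrable (fun z : ℝ × EuclideanSpace ℝ (Fin 3) => ⟪driftField W z.1 z.2, gradient (θ z.1) z.2⟫) :=
    integrable_inner_of_locallyIntegrableOn hhli cg hθ.hasCompactSupport hθ.tsupport_subset zg
  have zero_of : ∀ (g : ℝ × EuclideanSpace ℝ (Fin 3) → EuclideanSpace ℝ (Fin 3)) (S : Set (ℝ × EuclideanSpace ℝ (Fin 3))),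
      tsupport (uncurry θ) ⊆ S → ∀ z ∉ S, ⟪g z, gradient (θ z.1) z.2⟫ = 0 := fun g S hS z hz => by
    rw [zg z fun h' => hz (hS h'), inner_zero_right]
  have e1 : ∫ z in (O : Set (ℝ × EuclideanSpace ℝ (Fin 3))), ⟪v z.1 z.2, gradient (θ z.1) z.2⟫ =
      (∫ z : ℝ × EuclideanSpace ℝ (Fin 3), ⟪W z.1 z.2, gradient (θ z.1) z.2⟫) -
        ∫ z : ℝ × EuclideanSpace ℝ (Fin 3), ⟪driftField W z.1 z.2, gradient (θ z.1) z.2⟫ := by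
    rw [setIntegral_eq_integral_of_forall_compl_eq_zero
      (zero_of (fun z => v z.1 z.2) _ hθ.tsupport_subset), ← integral_sub IW Ih]
    refine integral_congr_ae (Eventually.of_forall fun z => ?_)
    simp only [hv, inner_sub_left]
  have e2 : ∫ z : ℝ × EuclideanSpace ℝ (Fin 3), ⟪W z.1 z.2, gradient (θ z.1) z.2⟫ = 0 := by
    rw [← setIntegral_eq_integral_of_forall_compl_eq_zero
      (zero_of (fun z => W z.1 z.2) _ hθ₂.tsupport_subset)]
    exact hWdiv θ hθ₂
  have e3 : ∫ z : ℝ × EuclideanSpace ℝ (Fin 3), ⟪driftField W z.1 z.2, gradient (θ z.1) z.2⟫ = 0 := by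
    rw [← setIntegral_eq_integral_of_forall_compl_eq_zero
      (zero_of (fun z => driftField W z.1 z.2) _ hθ.tsupport_subset)]
    exact divFree_driftField hW hO (fun _ _ => rfl) θ hθ
  rw [e1, e2, e3, sub_zero]

end DivFree


end Kwon2023

end Literature.Analysis.FluidPDE

end
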